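import Literature.RepresentationTheory.BorelWallach2000.UpqTypeFunctoriality
import HarnessLib

/-!
# Isomorphism classes of irreducible `(𝔤, K)`-modules (`GKIrrClass`)

Topic `RepresentationTheory` (file placed here per the cell's P3 planner, RULING (V8)); namespace
`Literature.NumberTheory.Automorphic` = the home of ★ `IsGKModule` ∕ `IsIrreducibleGK` ∕ `GKEquiv` ∕ `AreGKEquivalent` (`GKModules`)
and of ★ `IrrClass` (`IrreducibleClasses`), whose design this file copies VERBATIM for `(𝔤, K)`-modules.  Definitions with
bodies and their computation rules only: no named fact, no `instance` declaration (the isomorphism setoid is a `def`, used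
through the explicit-setoid `Quotient` API), no notation, no `sorry`; import cone = ★ `GKModules` via ★ `BorelWallach2000.UpqTypeFunctoriality` (the home of ★
`GKEquiv.symm'` ∕ `AreGKEquivalent.symm'`, reused — gate dedup).

THE MATHEMATICS (Wallach, *Real Reductive Groups I* §3.3.1; Knapp–Vogan §II.4; Borel–Wallach I §4.3).  For a linear real group
`G : RealMatrixGroup A N` with `K = G.maximalCompact`, `𝔤 = G.lie`, an IRREDUCIBLE `(𝔤, K)`-MODULE is a complex vector space `V`
with `ρK : Representation ℂ K V`, `ρ𝔤 : 𝔤 →ₗ⁅ℝ⁆ End_ℂ V` satisfying ★ `IsGKModule G ρK ρ𝔤` and ★ `IsIrreducibleGK ρK ρ𝔤`; two such are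
ISOMORPHIC when there is a ★ `GKEquiv` between them (★ `AreGKEquivalent` = `Nonempty (GKEquiv …)`), an equivalence relation
(`GKEquiv.refl` ★, `GKEquiv.symm'` ★, `GKEquiv.trans` below).  The set of isomorphism classes — Harish-Chandra's «infinitesimal
equivalence classes», the archimedean analogue of `Irr(G)` for a `p`-adic group — is the type `GKIrrClass G`, the quotient of
the bundled irreducible `(𝔤, K)`-modules `GKIrrep G` (carrier `V : Type`, as ★ `SmoothIrrep`; the carrier's `AddCommGroup`∕`Module`
structure fields are registered as instances on the projections exactly as ★ `SmoothIrrep.instAddCommGroup`∕`instModule` and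
Mathlib's `ModuleCat.isAddCommGroup`∕`isModule` — attributes on THIS file's new bundled carrier only) by that relation.  A bundled
carrier (rather than structures on one fixed space) is forced: finite- and infinite-dimensional irreducible `(𝔤, K)`-modules
must live in the same class type.  Intended consumer: the archimedean coordinate `Cinf` ∕ `infCls` of the cell's classification
kit (rung-4 integrator T5), which reads `GKIrrClass.ofModule M σK σ𝔤 hM hirr`.

* `GKEquiv.trans`, `AreGKEquivalent.trans`, `areGKEquivalent_comm` — with ★ `GKEquiv.refl` and ★ `GKEquiv.symm'` ∕
  `AreGKEquivalent.symm'` (`UpqTypeFunctoriality`, imported) the equivalence-relation API of ★ `GKEquiv` (★ `GKEquiv.trans'` ∕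
  `AreGKEquivalent.trans'` exist only inside the `U(1,1)` discrete-series cone `U11DiscreteSeriesCoefficientsIrreducible`, too heavy to
  import for a generic class file — TODO(dedup): re-point them here);
* `GKIrrep G` (bundled irreducible `(𝔤, K)`-module), `GKIrrep.setoid` (a `def`), `GKIrrep.equiv_iff`;
* `GKIrrClass G := Quotient (GKIrrep.setoid G)`, `GKIrrClass.mk`, `mk_eq_mk_iff`, `mk_eq_mk_of_equiv`, `mk_surjective`, `ind`,
  `liftProp` ∕ `liftProp_mk`, and the unbundled constructor `GKIrrClass.ofModule` with `ofModule_eq_ofModule_iff`.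

## References
* N. R. Wallach, *Real Reductive Groups I*, Academic Press (1988), §3.3.1.
* A. W. Knapp, D. A. Vogan, *Cohomological Induction and Unitary Representations*, Princeton (1995), §II.4.
* A. Borel, N. Wallach, *Continuous Cohomology, Discrete Subgroups, and Representations of Reductive Groups*, 2nd ed. (2000), I §4.3.
-/

set_option autoImplicit false

-- Mathlib idiom (Mathlib/Algebra/Lie/OfAssociative.lean), as in ★ `GKModules`: the associative algebra `Module.End ℂ V` as a Lie ring,
-- needed to even state `ρ𝔤 : G.lie →ₗ⁅ℝ⁆ Module.End ℂ V`.
attribute [local instance 100] LieRing.ofAssociativeRing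

namespace Literature.NumberTheory.Automorphic

universe uA uN

variable {A : Type uA} [NormedCommRing A] [NormedAlgebra ℝ A] [NormedAlgebra ℚ A] [CompleteSpace A]
  [StarRing A] {N : Type uN} [Fintype N] [DecidableEq N] {G : RealMatrixGroup A N}

/-! ## §1 `(𝔤, K)`-equivalence is an equivalence relation -/

section EquivAPI

variable {V : Type*} [AddCommGroup V] [Module ℂ V]
  {ρK : Representation ℂ G.maximalCompact V} {ρ𝔤 : G.lie →ₗ⁅ℝ⁆ Module.End ℂ V}
  {W : Type*} [AddCommGroup W] [Module ℂ W]
  {σK : Representation ℂ G.maximalCompact W} {σ𝔤 : G.lie →ₗ⁅ℝ⁆ Module.End ℂ W}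
  {W' : Type*} [AddCommGroup W'] [Module ℂ W']
  {τK : Representation ℂ G.maximalCompact W'} {τ𝔤 : G.lie →ₗ⁅ℝ⁆ Module.End ℂ W'}

/-- Composition of `(𝔤, K)`-equivalences. Wallach §3.3.1. [cite: BorelWallach2000, I §4.3] -/
def GKEquiv.trans (e₁ : GKEquiv ρK ρ𝔤 σK σ𝔤) (e₂ : GKEquiv σK σ𝔤 τK τ𝔤) : GKEquiv ρK ρ𝔤 τK τ𝔤 where
  toLinearEquiv := e₁.toLinearEquiv.trans e₂.toLinearEquiv
  map_ρK k v := by rw [LinearEquiv.trans_apply, e₁.map_ρK, e₂.map_ρK, LinearEquiv.trans_apply]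
  map_ρ𝔤 X v := by rw [LinearEquiv.trans_apply, e₁.map_ρ𝔤, e₂.map_ρ𝔤, LinearEquiv.trans_apply]

/-- Computation rule: the linear isomorphism underlying `e₁.trans e₂`. [cite: BorelWallach2000, I §4.3] -/
@[simp] theorem GKEquiv.toLinearEquiv_trans (e₁ : GKEquiv ρK ρ𝔤 σK σ𝔤) (e₂ : GKEquiv σK σ𝔤 τK τ𝔤) :
    (e₁.trans e₂).toLinearEquiv = e₁.toLinearEquiv.trans e₂.toLinearEquiv := rfl

/-- `(𝔤, K)`-equivalence of modules is transitive. [cite: BorelWallach2000, I §4.3] -/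
theorem AreGKEquivalent.trans (h₁ : AreGKEquivalent ρK ρ𝔤 σK σ𝔤) (h₂ : AreGKEquivalent σK σ𝔤 τK τ𝔤) :
    AreGKEquivalent ρK ρ𝔤 τK τ𝔤 :=
  h₁.elim fun e₁ => h₂.elim fun e₂ => ⟨e₁.trans e₂⟩

/-- Symmetric form of `AreGKEquivalent` as an `iff`. [cite: BorelWallach2000, I §4.3] -/
theorem areGKEquivalent_comm : AreGKEquivalent ρK ρ𝔤 σK σ𝔤 ↔ AreGKEquivalent σK σ𝔤 ρK ρ𝔤 :=
  ⟨AreGKEquivalent.symm', AreGKEquivalent.symm'⟩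

end EquivAPI

/-! ## §2 Bundled irreducible `(𝔤, K)`-modules and their isomorphism setoid -/

variable [StarModule ℝ A] [ContinuousStar A]

variable (G) in
/-- An **irreducible `(𝔤, K)`-module of `G`**, bundled: a complex vector space `V` (in `Type`, as ★ `SmoothIrrep`), a
`K`-action `ρK`, a real Lie algebra action `ρ𝔤` of `𝔤 = G.lie`, and proofs of the `(𝔤, K)`-axioms (★ `IsGKModule`) and of
irreducibility (★ `IsIrreducibleGK`).  Wallach §3.3.1; Knapp–Vogan §II.4. [cite: KnappVogan1995, §II.4] -/
structure GKIrrep : Type (max uA uN 1) where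
  /-- The module. -/
  V : Type
  /-- The additive group structure on `V`. -/
  [instAddCommGroup : AddCommGroup V]
  /-- The `ℂ`-vector space structure on `V`. -/
  [instModule : Module ℂ V]
  /-- The action of `K = G.maximalCompact`. -/
  ρK : Representation ℂ G.maximalCompact V
  /-- The action of `𝔤 = G.lie`. -/
  ρ𝔤 : G.lie →ₗ⁅ℝ⁆ Module.End ℂ V
  /-- The `(𝔤, K)`-module axioms. -/
  isGKModule : IsGKModule G ρK ρ𝔤
  /-- Irreducibility. -/
  isIrreducible : IsIrreducibleGK ρK ρ𝔤

attribute [instance] GKIrrep.instAddCommGroup GKIrrep.instModule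

namespace GKIrrep

variable (G) in
/-- Two irreducible `(𝔤, K)`-modules are **isomorphic** when there is a `(𝔤, K)`-equivalence between them (★ `AreGKEquivalent`);
an equivalence relation by ★ `GKEquiv.refl` ∕ ★ `GKEquiv.symm'` ∕ `GKEquiv.trans`.  A `def`, not an instance: the quotient below uses the
explicit-setoid API. Wallach §3.3.1. [cite: BorelWallach2000, I §4.3] -/
def setoid : Setoid (GKIrrep G) where
  r r₁ r₂ := AreGKEquivalent r₁.ρK r₁.ρ𝔤 r₂.ρK r₂.ρ𝔤
  iseqv :=
    { refl := fun r => AreGKEquivalent.refl r.ρK r.ρ𝔤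
      symm := fun h => h.symm'
      trans := fun h₁ h₂ => h₁.trans h₂ }

/-- Unfolding lemma for the isomorphism setoid. [cite: BorelWallach2000, I §4.3] -/
theorem equiv_iff (r₁ r₂ : GKIrrep G) : (GKIrrep.setoid G).r r₁ r₂ ↔ AreGKEquivalent r₁.ρK r₁.ρ𝔤 r₂.ρK r₂.ρ𝔤 := Iff.rfl

end GKIrrep

/-! ## §3 The class type `GKIrrClass G` -/

variable (G) in
/-- **The isomorphism classes of irreducible `(𝔤, K)`-modules of `G`** (Harish-Chandra's infinitesimal equivalence classes;
the archimedean analogue of ★ `IrrClass`): the quotient of `GKIrrep G` by `(𝔤, K)`-equivalence. Wallach §3.3.1; Knapp–Vogan §II.4.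
[cite: KnappVogan1995, §II.4] -/
def GKIrrClass : Type (max uA uN 1) :=
  Quotient (GKIrrep.setoid G)

namespace GKIrrClass

/-- The isomorphism class `[M]` of an irreducible `(𝔤, K)`-module. [cite: KnappVogan1995, §II.4] -/
def mk (r : GKIrrep G) : GKIrrClass G := Quotient.mk (GKIrrep.setoid G) r

/-- Two irreducible `(𝔤, K)`-modules have the same class iff they are `(𝔤, K)`-equivalent. [cite: KnappVogan1995, §II.4] -/
theorem mk_eq_mk_iff (r₁ r₂ : GKIrrep G) : mk r₁ = mk r₂ ↔ AreGKEquivalent r₁.ρK r₁.ρ𝔤 r₂.ρK r₂.ρ𝔤 :=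
  Quotient.eq (r := GKIrrep.setoid G)

/-- Equivalent modules have the same class. [cite: KnappVogan1995, §II.4] -/
theorem mk_eq_mk_of_equiv {r₁ r₂ : GKIrrep G} (e : GKEquiv r₁.ρK r₁.ρ𝔤 r₂.ρK r₂.ρ𝔤) : mk r₁ = mk r₂ :=
  Quotient.sound (s := GKIrrep.setoid G) ⟨e⟩

/-- Every class is the class of some module. [cite: KnappVogan1995, §II.4] -/
theorem mk_surjective : Function.Surjective (mk : GKIrrep G → GKIrrClass G) :=
  Quotient.mk_surjective

/-- **Induction principle**: a property of all classes follows from the property of all classes of representatives.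
[cite: KnappVogan1995, §II.4] -/
@[elab_as_elim]
protected theorem ind {P : GKIrrClass G → Prop} (h : ∀ r : GKIrrep G, P (mk r)) (c : GKIrrClass G) : P c :=
  Quotient.ind (s := GKIrrep.setoid G) h c

/-- Descend a predicate on irreducible `(𝔤, K)`-modules to classes, given invariance under `(𝔤, K)`-equivalence (one direction
suffices, by ★ `GKEquiv.symm'`) — the helper through which unitarizability, cohomology types, … are read on classes.
[cite: KnappVogan1995, §II.4] -/
def liftProp (P : GKIrrep G → Prop) (hP : ∀ r₁ r₂ : GKIrrep G, GKEquiv r₁.ρK r₁.ρ𝔤 r₂.ρK r₂.ρ𝔤 → P r₁ → P r₂) :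
    GKIrrClass G → Prop :=
  Quotient.lift (s := GKIrrep.setoid G) P fun r₁ r₂ h => h.elim fun e => propext ⟨hP r₁ r₂ e, hP r₂ r₁ e.symm'⟩

/-- Computation rule for `liftProp` on a class `[r]`. [cite: KnappVogan1995, §II.4] -/
@[simp] theorem liftProp_mk (P : GKIrrep G → Prop)
    (hP : ∀ r₁ r₂ : GKIrrep G, GKEquiv r₁.ρK r₁.ρ𝔤 r₂.ρK r₂.ρ𝔤 → P r₁ → P r₂) (r : GKIrrep G) :
    liftProp P hP (mk r) ↔ P r := Iff.rfl

/-- **Unbundled constructor**: the class of an irreducible `(𝔤, K)`-module given as data `(M, σK, σ𝔤)` with its two proofs —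
the shape in which consumers hold archimedean components (e.g. a Harish-Chandra module `M` with `IsGKModule` and
`IsIrreducibleGK` witnesses). [cite: KnappVogan1995, §II.4] -/
def ofModule (M : Type) [AddCommGroup M] [Module ℂ M] (σK : Representation ℂ G.maximalCompact M)
    (σ𝔤 : G.lie →ₗ⁅ℝ⁆ Module.End ℂ M) (hM : IsGKModule G σK σ𝔤) (hirr : IsIrreducibleGK σK σ𝔤) : GKIrrClass G :=
  mk ⟨M, σK, σ𝔤, hM, hirr⟩

/-- `ofModule` is `mk` of the bundled module. [cite: KnappVogan1995, §II.4] -/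
theorem ofModule_eq_mk (M : Type) [AddCommGroup M] [Module ℂ M] (σK : Representation ℂ G.maximalCompact M)
    (σ𝔤 : G.lie →ₗ⁅ℝ⁆ Module.End ℂ M) (hM : IsGKModule G σK σ𝔤) (hirr : IsIrreducibleGK σK σ𝔤) :
    ofModule M σK σ𝔤 hM hirr = mk ⟨M, σK, σ𝔤, hM, hirr⟩ := rfl

/-- Two modules given as data have the same class iff they are `(𝔤, K)`-equivalent. [cite: KnappVogan1995, §II.4] -/
theorem ofModule_eq_ofModule_iff (M : Type) [AddCommGroup M] [Module ℂ M] (σK : Representation ℂ G.maximalCompact M)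
    (σ𝔤 : G.lie →ₗ⁅ℝ⁆ Module.End ℂ M) (hM : IsGKModule G σK σ𝔤) (hirr : IsIrreducibleGK σK σ𝔤)
    (M' : Type) [AddCommGroup M'] [Module ℂ M'] (σK' : Representation ℂ G.maximalCompact M')
    (σ𝔤' : G.lie →ₗ⁅ℝ⁆ Module.End ℂ M') (hM' : IsGKModule G σK' σ𝔤') (hirr' : IsIrreducibleGK σK' σ𝔤') :
    ofModule M σK σ𝔤 hM hirr = ofModule M' σK' σ𝔤' hM' hirr' ↔ AreGKEquivalent σK σ𝔤 σK' σ𝔤' :=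
  mk_eq_mk_iff _ _

/-- Every class is `ofModule` of some data. [cite: KnappVogan1995, §II.4] -/
theorem exists_ofModule_eq (c : GKIrrClass G) :
    ∃ r : GKIrrep G, ofModule r.V r.ρK r.ρ𝔤 r.isGKModule r.isIrreducible = c := by
  induction c using GKIrrClass.ind with
  | h r => exact ⟨r, rfl⟩

end GKIrrClass

end Literature.NumberTheory.Automorphic
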